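import Summits.CriticalPhenomena.PercolationContinuityZ3.Theorems.PercNearOneGluingNoHeavyLowerTailConditionalSelectionHolds
import Summits.CriticalPhenomena.PercolationContinuityZ3.Theorems.PercNearOneGluingNoHeavyLowerTailCumulativeIsolation
import HarnessLib

/-!
# `NoHeavyLowerTail` (stmt-CriticalPhenomena-4575) — the COVARIANCE-GLUING / unweighted selection inequality (U) is a theorem

Support file (`--supports stmt-CriticalPhenomena-4575`), prover `prim-ineq-gen-6` (gen 10; memo FINDING-G10 §5).  No
definitions, no named facts, no sorries; standard axioms.

Notation of `…ConditionalSelectionHolds.lean`: `δ_a = μ(a ↮ c)`, `𝔸 = {o ↔ A}`, `V_a = {a is the worst-ranked relay of o's block}`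
(`δ`-maximal, smallest index among ties; `⊔_a V_a = 𝔸`).  The registered stub `stub_covGluing` (gen-kcluster gen 4, "(U)";
= prim-hp-4's selection principle SEL at the target `∋ c`; census 0 viol `n ≤ 8`, `k ≤ 6`):

  `Σ_{a ∈ A} μ(V_a)·μ(a ↔ c) ≤ μ({o ↔ c} ∩ 𝔸)`.

PROOF = Kozma–Nitzan's Conjecture 4 (`Q7Psi.kn_conj4_designated`, every weight vector) for the monotone cluster functional
`F(S) = 1{c ∈ S} + max_{x ∈ S∩A} δ_x`: `E F(C_a) ≥ 1 = E F(C_{a₁})` for the globally worst relay `a₁`,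
`∫_𝔸 F(C_o) ≤ μ(𝔸, o ↔ c) + Σ_a μ(V_a) δ_a` (on `𝔸` the maximum is the `δ` of the worst relay of `o`'s block),
`∫_𝔸 F(C_{a₁}) ≥ μ(𝔸, a₁ ↔ c) + δ_{a₁} μ(𝔸)`, Harris `μ(𝔸, a₁ ↔ c) ≥ μ(𝔸)μ(a₁ ↔ c)` and `Σ_a μ(V_a) ≤ μ(𝔸)` give (U).
[cite: KozmaNitzan2024, Conjecture 4 (p. 32)] [cite: Harris1960]
-/

noncomputable section

namespace Summit.CriticalPhenomena.PercolationContinuityZ3.Theorems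

open MeasureTheory Set Literature.Probability.LatticeModels Literature.Probability.Percolation
open scoped Classical

namespace CSLHolds

variable {n : ℕ}

/-! ### U: the covariance-gluing (unweighted selection) inequality -/

/-- **Registered stub `stub_covGluing` (gen-kcluster, COVARIANCE GLUING U = prim-hp-4's selection principle at the target
`∋ c`), verbatim**: `Σ_{a∈A} μ(V_a)·μ(a ↔ c) ≤ μ({o ↔ c} ∩ {o ↔ A})`, `V_a = {a is the worst-ranked relay of o's block}`.
Kozma–Nitzan's Conjecture 4 for `F(S) = 1{c ∈ S} + max_{x ∈ S∩A} δ_x`, plus Harris. [this work]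
[cite: KozmaNitzan2024, Conjecture 4 (p. 32)] [cite: Harris1960] -/
theorem stub_covGluing :
    ∀ (n : ℕ) (w : Sym2 (Fin n) → unitInterval) (A : Finset (Fin n)) (o c : Fin n),
      ∑ a ∈ A, (Literature.Probability.LatticeModels.prodBernoulli w).real
          {ω : Literature.Probability.Percolation.BondConfig (Fin n) |
            (Literature.Probability.Percolation.openGraph ω).Reachable o a ∧
            ∀ x ∈ A, (Literature.Probability.Percolation.openGraph ω).Reachable o x →
              ((Literature.Probability.LatticeModels.prodBernoulli w).real
                  (Literature.Probability.Percolation.openConn x c :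
                    Set (Literature.Probability.Percolation.BondConfig (Fin n)))ᶜ <
                (Literature.Probability.LatticeModels.prodBernoulli w).real
                  (Literature.Probability.Percolation.openConn a c :
                    Set (Literature.Probability.Percolation.BondConfig (Fin n)))ᶜ ∨
              ((Literature.Probability.LatticeModels.prodBernoulli w).real
                  (Literature.Probability.Percolation.openConn x c :
                    Set (Literature.Probability.Percolation.BondConfig (Fin n)))ᶜ =
                (Literature.Probability.LatticeModels.prodBernoulli w).real
                  (Literature.Probability.Percolation.openConn a c :
                    Set (Literature.Probability.Percolation.BondConfig (Fin n)))ᶜ ∧ a ≤ x))} *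
        (Literature.Probability.LatticeModels.prodBernoulli w).real
          (Literature.Probability.Percolation.openConn a c :
            Set (Literature.Probability.Percolation.BondConfig (Fin n))) ≤
      (Literature.Probability.LatticeModels.prodBernoulli w).real
        ((Literature.Probability.Percolation.openConn o c :
            Set (Literature.Probability.Percolation.BondConfig (Fin n))) ∩
          ⋃ a ∈ A, Literature.Probability.Percolation.openConn o a) := by
  intro n w A o c
  set μ := prodBernoulli w with hμ
  haveI : IsProbabilityMeasure μ := by rw [hμ]; infer_instance
  have hmeas : ∀ S : Set (BondConfig (Fin n)), MeasurableSet S := fun _ => MeasurableSet.of_discrete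
  have hint : ∀ (g : BondConfig (Fin n) → ℝ), Integrable g μ := fun g => Integrable.of_finite
  have hintr : ∀ (g : BondConfig (Fin n) → ℝ) (S : Set (BondConfig (Fin n))), Integrable g (μ.restrict S) :=
    fun g S => Integrable.of_finite
  set δ : Fin n → ℝ := fun a => μ.real (openConn a c : Set (BondConfig (Fin n)))ᶜ with hδ
  set U : Set (BondConfig (Fin n)) := ⋃ a ∈ A, (openConn o a : Set (BondConfig (Fin n))) with hU
  set V : Fin n → Set (BondConfig (Fin n)) := fun a =>
    {ω : BondConfig (Fin n) | ω ∈ openConn o a ∧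
      ∀ x ∈ A, ω ∈ openConn o x → (δ x < δ a ∨ (δ x = δ a ∧ a ≤ x))} with hV
  change (∑ a ∈ A, μ.real (V a) * μ.real (openConn a c : Set (BondConfig (Fin n)))) ≤
    μ.real ((openConn o c : Set (BondConfig (Fin n))) ∩ U)
  have hδ0 : ∀ a, 0 ≤ δ a := fun a => measureReal_nonneg
  have hcompl : ∀ a : Fin n, μ.real (openConn a c : Set (BondConfig (Fin n))) = 1 - δ a := by
    intro a
    have h := probReal_compl_eq_one_sub (μ := μ) (s := (openConn a c : Set (BondConfig (Fin n)))) (hmeas _)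
    change δ a = 1 - μ.real (openConn a c : Set (BondConfig (Fin n))) at h
    linarith
  rcases A.eq_empty_or_nonempty with hAe | hAne
  · rw [hAe, Finset.sum_empty]; exact measureReal_nonneg
  obtain ⟨a₁, ha₁, hworst₁⟩ := worst_exists δ A hAne
  have hle₁ : ∀ x ∈ A, δ x ≤ δ a₁ := fun x hx => by
    rcases hworst₁ x hx with h | ⟨h, _⟩
    · exact h.le
    · exact h.le
  -- `Mx(S) = max_{x ∈ S ∩ A} δ_x` (or `0`)
  set Mx : Set (Fin n) → ℝ := fun S =>
    if h : (A.filter fun x => x ∈ S).Nonempty then (A.filter fun x => x ∈ S).sup' h δ else 0 with hMx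
  have hMx0 : ∀ S, 0 ≤ Mx S := by
    intro S
    by_cases hne : (A.filter fun x => x ∈ S).Nonempty
    · simp only [hMx, dif_pos hne]
      obtain ⟨x, hx⟩ := hne
      exact (hδ0 x).trans (Finset.le_sup' δ hx)
    · simp only [hMx, dif_neg hne]; exact le_refl _
  have hMx1 : ∀ (S : Set (Fin n)), ∀ a ∈ A, a ∈ S → δ a ≤ Mx S := by
    intro S a ha haS
    have hmem : a ∈ A.filter fun x => x ∈ S := Finset.mem_filter.2 ⟨ha, haS⟩
    have hne : (A.filter fun x => x ∈ S).Nonempty := ⟨a, hmem⟩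
    simp only [hMx, dif_pos hne]
    exact Finset.le_sup' δ hmem
  have hMx2 : ∀ S : Set (Fin n), Mx S ≤ δ a₁ := by
    intro S
    by_cases hne : (A.filter fun x => x ∈ S).Nonempty
    · simp only [hMx, dif_pos hne]
      exact Finset.sup'_le hne δ fun x hx => hle₁ x (Finset.mem_filter.1 hx).1
    · simp only [hMx, dif_neg hne]; exact hδ0 a₁
  have hMx3 : ∀ S T : Set (Fin n), S ⊆ T → Mx S ≤ Mx T := by
    intro S T hST
    by_cases hneS : (A.filter fun x => x ∈ S).Nonempty
    · have hsub : (A.filter fun x => x ∈ S) ⊆ (A.filter fun x => x ∈ T) :=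
        Finset.monotone_filter_right A fun _ _ hx => hST hx
      have hneT : (A.filter fun x => x ∈ T).Nonempty := hneS.mono hsub
      simp only [hMx, dif_pos hneS, dif_pos hneT]
      exact Finset.sup'_le hneS δ fun x hx => Finset.le_sup' δ (hsub hx)
    · simp only [hMx, dif_neg hneS]; exact hMx0 T
  -- the functional
  set F : Set (Fin n) → ℝ := fun S => (if c ∈ S then (1 : ℝ) else 0) + Mx S with hF
  have hFmono : ∀ S T : Set (Fin n), S ⊆ T → F S ≤ F T := by
    intro S T hST
    have h1 : (if c ∈ S then (1 : ℝ) else 0) ≤ (if c ∈ T then (1 : ℝ) else 0) := by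
      by_cases hcS : c ∈ S
      · rw [if_pos hcS, if_pos (hST hcS)]
      · rw [if_neg hcS]; by_cases hcT : c ∈ T
        · rw [if_pos hcT]; exact zero_le_one
        · rw [if_neg hcT]
    simp only [hF]
    linarith [hMx3 S T hST]
  -- `∫ F(C a) = μ(a ↔ c) + ∫ Mx(C a)`
  have hsplit : ∀ (a : Fin n) (E : Set (BondConfig (Fin n))),
      ∫ ω in E, F (openCluster ω a) ∂μ =
        μ.real (openConn a c ∩ E) + ∫ ω in E, Mx (openCluster ω a) ∂μ := by
    intro a E
    simp only [hF]
    rw [integral_add (hintr _ _) (hintr _ _), hμ, Q7Psi.setIntegral_ite_mem_openCluster, ← hμ]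
  -- designated least-mean relay: `∫ F(C a₁) ≤ 1 ≤ ∫ F(C a)`
  have hlow : ∀ a ∈ A, 1 ≤ ∫ ω, F (openCluster ω a) ∂μ := by
    intro a ha
    rw [← setIntegral_univ, hsplit a Set.univ, Set.inter_univ, hcompl a]
    have hI : ∫ ω in Set.univ, (fun _ => δ a) ω ∂μ ≤ ∫ ω in Set.univ, Mx (openCluster ω a) ∂μ :=
      setIntegral_mono (hintr _ _) (hintr _ _) fun ω => hMx1 _ a ha (mem_openCluster_self ω a)
    rw [setIntegral_const, smul_eq_mul, probReal_univ, one_mul] at hI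
    linarith
  have hup : ∫ ω, F (openCluster ω a₁) ∂μ ≤ 1 := by
    rw [← setIntegral_univ, hsplit a₁ Set.univ, Set.inter_univ, hcompl a₁]
    have hI : ∫ ω in Set.univ, Mx (openCluster ω a₁) ∂μ ≤ ∫ ω in Set.univ, (fun _ => δ a₁) ω ∂μ :=
      setIntegral_mono (hintr _ _) (hintr _ _) fun ω => hMx2 _
    rw [setIntegral_const, smul_eq_mul, probReal_univ, one_mul] at hI
    linarith
  have hmin : ∀ a ∈ A, ∫ ω, F (openCluster ω a₁) ∂μ ≤ ∫ ω, F (openCluster ω a) ∂μ :=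
    fun a ha => hup.trans (hlow a ha)
  -- Conjecture 4, designated form
  have key := Q7Psi.kn_conj4_designated w A o a₁ F hFmono ha₁ hmin
  rw [← hμ] at key
  change ∫ ω in U, F (openCluster ω a₁) ∂μ ≤ ∫ ω in U, F (openCluster ω o) ∂μ at key
  rw [hsplit a₁ U, hsplit o U] at key
  -- observer side: `∫_U Mx(C_o) ≤ Σ_a μ(V_a) δ_a`
  have hobs : ∫ ω in U, Mx (openCluster ω o) ∂μ ≤ ∑ a ∈ A, μ.real (V a) * δ a := by
    rw [← integral_indicator (hmeas U)]
    have hpt : ∀ ω, U.indicator (fun ω => Mx (openCluster ω o)) ω ≤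
        ∑ a ∈ A, (V a).indicator (fun _ => δ a) ω := by
      intro ω
      have hnn : 0 ≤ ∑ a ∈ A, (V a).indicator (fun _ => δ a) ω :=
        Finset.sum_nonneg fun a _ => Set.indicator_nonneg (fun _ _ => hδ0 a) _
      by_cases hωU : ω ∈ U
      · rw [Set.indicator_of_mem hωU]
        -- the worst relay of `π(o)` exists
        set B := A.filter fun x => ω ∈ openConn o x with hB
        have hBne : B.Nonempty := by
          obtain ⟨a, ha, h⟩ := Set.mem_iUnion₂.1 hωU
          exact ⟨a, Finset.mem_filter.2 ⟨ha, h⟩⟩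
        obtain ⟨a, haB, hwa⟩ := worst_exists δ B hBne
        have haA : a ∈ A := (Finset.mem_filter.1 haB).1
        have hoa : ω ∈ openConn o a := (Finset.mem_filter.1 haB).2
        have hωV : ω ∈ V a := ⟨hoa, fun x hx hox => hwa x (Finset.mem_filter.2 ⟨hx, hox⟩)⟩
        have hterm : δ a ≤ ∑ x ∈ A, (V x).indicator (fun _ => δ x) ω := by
          have := Finset.single_le_sum (f := fun x => (V x).indicator (fun _ => δ x) ω)
            (fun x _ => Set.indicator_nonneg (fun _ _ => hδ0 x) _) haA
          rw [Set.indicator_of_mem hωV] at this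
          exact this
        refine le_trans ?_ hterm
        -- `Mx(C_o) ≤ δ_a`
        have hBeq : (A.filter fun x => x ∈ openCluster ω o) = B := CIL.filter_mem_openCluster A ω o
        have hne : (A.filter fun x => x ∈ openCluster ω o).Nonempty := by rw [hBeq]; exact hBne
        simp only [hMx, dif_pos hne]
        refine Finset.sup'_le hne δ fun x hx => ?_
        rw [hBeq] at hx
        rcases hwa x hx with h | ⟨h, _⟩
        · exact h.le
        · exact h.le
      · rw [Set.indicator_of_notMem hωU]; exact hnn
    have hI := integral_mono (hint _) (hint _) hpt
    rw [integral_sum_indicator] at hI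
    exact hI
  -- relay side: `∫_U Mx(C a₁) ≥ δ a₁ μ(U)`
  have hrel : δ a₁ * μ.real U ≤ ∫ ω in U, Mx (openCluster ω a₁) ∂μ := by
    have hI : ∫ ω in U, (fun _ => δ a₁) ω ∂μ ≤ ∫ ω in U, Mx (openCluster ω a₁) ∂μ :=
      setIntegral_mono (hintr _ _) (hintr _ _) fun ω => hMx1 _ a₁ ha₁ (mem_openCluster_self ω a₁)
    rw [setIntegral_const, smul_eq_mul] at hI
    linarith
  -- Harris: `{o ↔ A}` and `{a₁ ↔ c}` increasing
  have hharris : μ.real U * μ.real (openConn a₁ c : Set (BondConfig (Fin n))) ≤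
      μ.real (U ∩ openConn a₁ c) :=
    prodBernoulli_harris w (QuantGapPlusOne.isUpperSet_touch A o) (isUpperSet_openConn a₁ c) (hmeas _) (hmeas _)
  rw [hcompl a₁, Set.inter_comm] at hharris
  -- disjointness: `Σ_a μ(V_a) ≤ μ(U)`
  have hdisj : (∑ a ∈ A, μ.real (V a)) ≤ μ.real U := by
    have hpt : ∀ ω, (∑ a ∈ A, (V a).indicator (fun _ => (1 : ℝ)) ω) ≤ U.indicator (fun _ => (1 : ℝ)) ω := by
      intro ω
      by_cases hex : ∃ a ∈ A, ω ∈ V a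
      · obtain ⟨a, ha, hωa⟩ := hex
        have hωU : ω ∈ U := Set.mem_iUnion₂.2 ⟨a, ha, hωa.1⟩
        rw [Set.indicator_of_mem hωU, Finset.sum_eq_single_of_mem a ha]
        · rw [Set.indicator_of_mem hωa]
        · intro b hb hba
          refine Set.indicator_of_notMem (fun hωb => hba ?_) _
          have hbB : b ∈ A.filter fun x => ω ∈ openConn o x := Finset.mem_filter.2 ⟨hb, hωb.1⟩
          have haB : a ∈ A.filter fun x => ω ∈ openConn o x := Finset.mem_filter.2 ⟨ha, hωa.1⟩
          exact worst_unique δ (A.filter fun x => ω ∈ openConn o x) hbB haB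
            (fun x hx => hωb.2 x (Finset.mem_filter.1 hx).1 (Finset.mem_filter.1 hx).2)
            (fun x hx => hωa.2 x (Finset.mem_filter.1 hx).1 (Finset.mem_filter.1 hx).2)
      · push Not at hex
        have hzero : ∀ a ∈ A, (V a).indicator (fun _ => (1 : ℝ)) ω = 0 := fun a ha =>
          Set.indicator_of_notMem (hex a ha) _
        rw [Finset.sum_congr rfl hzero, Finset.sum_const_zero]
        exact Set.indicator_nonneg (fun _ _ => zero_le_one) _
    have hI := integral_mono (hint _) (hint _) hpt
    rw [integral_sum_indicator, integral_indicator_const _ (hmeas _), smul_eq_mul, mul_one] at hI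
    simpa only [mul_one] using hI
  -- assemble: `Σ μ(V_a)(1 - δ_a) ≤ μ(U) - Σ μ(V_a) δ_a ≤ μ({o↔c} ∩ U)`
  have hLHS : (∑ a ∈ A, μ.real (V a) * μ.real (openConn a c : Set (BondConfig (Fin n)))) =
      (∑ a ∈ A, μ.real (V a)) - ∑ a ∈ A, μ.real (V a) * δ a := by
    rw [← Finset.sum_sub_distrib]
    refine Finset.sum_congr rfl fun a _ => ?_
    rw [hcompl a]; ring
  rw [hLHS]
  linarith

end CSLHolds

end Summit.CriticalPhenomena.PercolationContinuityZ3.Theorems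

end
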